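import Literature.Analysis.FluidPDE.AdaptedBackwardKernel
import Literature.Analysis.FluidPDE.VorticityCalculus
import HarnessLib

/-!
# Positivity of the adapted enstrophy of a non-degenerate slice
# (route `AdaptedFrequency`, item `TangentFlowTransfer`, stmt-NavierStokesRegularity-10494)

Helper file (all results proved). The last clause of `TangentFlowTransfer` asks for
`H̄(τ) = ∫ ‖curl v(τ)‖² K(τ) > 0` at every `τ < 0`. Given the non-degeneracy of the tangent flow
(`curl v(τ) ≢ 0`, hypothesis (C) of the assembly) this is elementary: the integrand is continuous,
nonnegative, positive somewhere, and integrable, and Lebesgue measure charges open sets.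

* `integral_mul_pos_of_continuous`: `0 < ∫ f K` for continuous `f ≥ 0`, `K > 0` with `f ≢ 0` and
  `f K` integrable;
* `adaptedEnstrophy_pos_of_exists_curl_ne_zero`: the adapted enstrophy of a `C¹` slice with
  bounded, somewhere non-vanishing curl against a positive continuous integrable kernel slice is
  positive.
-/

noncomputable section

open MeasureTheory Set Function Filter TopologicalSpace Metric
open scoped Topology

namespace Summit.NavierStokesRegularity.NavierStokesRegularity.Theorems

open Literature.Analysis Literature.Analysis.FluidPDE

variable {E : Type*} [NormedAddCommGroup E] [InnerProductSpace ℝ E] [FiniteDimensional ℝ E]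
  [MeasurableSpace E] [BorelSpace E]

/-- **A continuous nonnegative integrand that is positive somewhere has positive integral**
against Lebesgue measure: `0 < ∫ f K` for continuous `f ≥ 0` and `K > 0` with `f x₀ ≠ 0` for some
`x₀` and `f K` integrable (the support of `f K` is a nonempty open set). [folklore] -/
theorem integral_mul_pos_of_continuous {f K : E → ℝ} (hf : Continuous f) (hK : Continuous K)
    (hf0 : ∀ x, 0 ≤ f x) (hKpos : ∀ x, 0 < K x) (hx : ∃ x, f x ≠ 0)
    (hint : Integrable (fun x => f x * K x) (volume : Measure E)) :
    0 < ∫ x, f x * K x := by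
  have hnn : ∀ x, 0 ≤ f x * K x := fun x => mul_nonneg (hf0 x) (hKpos x).le
  rw [integral_pos_iff_support_of_nonneg (fun x => hnn x) hint]
  have hopen : IsOpen (support fun x => f x * K x) := (hf.mul hK).isOpen_support
  obtain ⟨x₀, hx₀⟩ := hx
  have hmem : x₀ ∈ support fun x => f x * K x := by
    rw [mem_support]
    exact mul_ne_zero hx₀ (hKpos x₀).ne'
  exact hopen.measure_pos volume ⟨x₀, hmem⟩

/-- **Positivity of the adapted enstrophy of a non-degenerate slice.** Let `v : ℝ³ → ℝ³` be `C¹`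
with `‖curl v‖ ≤ M` and `curl v x₀ ≠ 0` for some `x₀`, and let `k : ℝ³ → ℝ` be continuous,
positive and integrable. Then `0 < ∫ ‖curl v x‖² k x dx`. [folklore] -/
theorem integral_norm_curl_sq_mul_pos
    {v : EuclideanSpace ℝ (Fin 3) → EuclideanSpace ℝ (Fin 3)} (hv : ContDiff ℝ 1 v) {M : ℝ}
    (hM : ∀ x, ‖curl v x‖ ≤ M) (hx : ∃ x, curl v x ≠ 0) {k : EuclideanSpace ℝ (Fin 3) → ℝ}
    (hk : Continuous k) (hkpos : ∀ x, 0 < k x) (hki : Integrable k volume) :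
    0 < ∫ x, ‖curl v x‖ ^ 2 * k x := by
  have hcurl : Continuous (curl v) := (contDiff_curl (n := 0) (by exact_mod_cast hv)).continuous
  have hf : Continuous fun x => ‖curl v x‖ ^ 2 := (hcurl.norm).pow 2
  have hM0 : 0 ≤ M := (norm_nonneg _).trans (hM 0)
  refine integral_mul_pos_of_continuous hf hk (fun x => sq_nonneg _) hkpos ?_ ?_
  · obtain ⟨x₀, hx₀⟩ := hx
    exact ⟨x₀, by positivity⟩
  · -- `‖curl v‖² k` is dominated by `M² |k|`
    refine (hki.norm.const_mul (M ^ 2)).mono' (hf.mul hk).aestronglyMeasurable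
      (Eventually.of_forall fun x => ?_)
    rw [Real.norm_eq_abs, abs_mul, abs_of_nonneg (sq_nonneg _), Real.norm_eq_abs]
    refine mul_le_mul_of_nonneg_right ?_ (abs_nonneg _)
    exact pow_le_pow_left₀ (norm_nonneg _) (hM x) 2

/-- The form consumed by the assembly: positivity of `adaptedEnstrophy v G τ` for a slice time
`τ` at which `curl (v τ)` is bounded and not identically zero and `G τ` is a continuous,
positive, integrable kernel slice. [folklore] -/
theorem adaptedEnstrophy_pos_of_exists_curl_ne_zero
    {v : ℝ → EuclideanSpace ℝ (Fin 3) → EuclideanSpace ℝ (Fin 3)}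
    {G : ℝ → EuclideanSpace ℝ (Fin 3) → ℝ} {τ : ℝ} (hv : ContDiff ℝ 1 (v τ)) {M : ℝ}
    (hM : ∀ x, ‖curl (v τ) x‖ ≤ M) (hx : ∃ x, curl (v τ) x ≠ 0) (hk : Continuous (G τ))
    (hkpos : ∀ x, 0 < G τ x) (hki : Integrable (G τ) volume) :
    0 < adaptedEnstrophy v G τ := by
  rw [adaptedEnstrophy_apply]
  exact integral_norm_curl_sq_mul_pos hv hM hx hk hkpos hki

end Summit.NavierStokesRegularity.NavierStokesRegularity.Theorems

end
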